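import Literature.Analysis.FluidPDE.OseenSliceLSixBound
import Literature.Analysis.FluidPDE.TypeIAncientMild
import Literature.Analysis.FluidPDE.EnstrophyGronwall
import Literature.Analysis.UnboundedOperators.HeatExtensionDecay
import Summits.NavierStokesRegularity.NavierStokesRegularity.Theorems.GaldiLiouvilleGateRecordZoomAncientStubSobolevModConst
import HarnessLib

/-!
# Route `LerayQuarterDissipation`, crux `FiniteDissipationLiouville` (stmt-NavierStokesRegularity-22144),
  line `birth` — stub `stub_smallDissipationGap` (the BC5 rung: the small-dissipation gap)

**Statement.** There is an absolute constant `K₀ > 0` such that every Type-I ancient mild field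
`w` in the KNSS gauge (`IsTypeIAncientMild C w`, any Type-I constant `C`) whose slices obey the
quarter-rate dissipation law `∫ ‖∇w(s)‖² ≤ K/√(−s)` (`s < 0`) with `K ≤ K₀` vanishes identically
on `t < 0`. (So small-`K` members of the finite-dissipation stratum are trivially bounded at the
apex; this is the first rung of the crux, not the crux, and nothing here bears on Navier–Stokes
regularity itself.)

**Proof (Duhamel from `4t` to `t`, after Chae–Wolf 2017 §3 Step 1 / KNSS 2009 §4).** Let
`B = sup_{t<0,x} √(−t)‖w(t,x)‖ ≤ C`. The Oseen identity of the class,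
`w(t) = e^{−3tΔ}w(4t) − ∫_{4t}^{t}∫ K(t−σ, x−y)[w(σ,y), w(σ,y)] dy dσ`, gives `√(−t)‖w(t,x)‖ ≤ B/2`
from the caloric term (heat flow is an `L^∞` contraction and `√(−4t) = 2√(−t)`) plus the Duhamel
term. For the latter, each slice `w(σ)` is a bounded `C¹` field with `∫‖∇w(σ)‖² ≤ K/√(−σ)`, so
Sobolev-modulo-constants (`Ḣ¹ ∩ L^∞(ℝ³) ⊂ L⁶ + const`, the tree's cut-off/Poincaré/GNS/Fatou
argument of `GaldiLiouvilleGateRecordZoomAncientStubSobolevModConst`, made quantitative here: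
`‖w(σ) − c_σ‖₆ ≤ C_S √(K/√(−σ))`, `‖c_σ‖ ≤ B/√(−σ)`) and the `L^∞ × L⁶` slice bound of the
Oseen–Koch–Tataru kernel (`exists_norm_integral_oseenKernel_le_lsix`: bilinearity, zero mean of
the kernel, Koch–Tataru (14), Hölder `(6/5,6)`) bound the slice by
`C₆ (t−σ)^{-3/4} · B/√(−σ) · C_S √K (−σ)^{-1/4} ≤ C₆ C_S B √K (t−σ)^{-3/4} (−t)^{-3/4}` on
`σ ∈ (4t, t)`; with `∫_{4t}^{t}(t−σ)^{-3/4}dσ = 4(−3t)^{1/4} ≤ 8(−t)^{1/4}` the Duhamel term is at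
most `8 C₆ C_S √K · B/√(−t)`. Hence `B ≤ B/2 + κ√K·B` with `κ = 8C₆C_S`, and `κ√K₀ ≤ 1/4` forces
`B = 0`.
-/

noncomputable section

open Set MeasureTheory Filter Topology Function Metric Real
open Literature.Analysis Literature.Analysis.FluidPDE
open scoped ENNReal NNReal

namespace Summit.NavierStokesRegularity.NavierStokesRegularity.Theorems.FiniteDissipationLiouville.Birth

-- the problem-side namespace duplicates `NavierStokesRegularity` by design (summit = problem)
set_option linter.dupNamespace false

open Summit.NavierStokesRegularity.NavierStokesRegularity.Theorems.RecordZoomAncient.Birth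
  (sobolevModConst_norm_setAverage_le sobolevModConst_eLpNorm_indicator_le)

/-! ### Sobolev embedding modulo constants, quantitative form -/

/-- **`Ḣ¹ ∩ L^∞(ℝ³) ⊂ L⁶ + constants`, quantitatively.** There is an absolute `C_S > 0` such that
every bounded `C¹` field `f : ℝ³ → ℝ³`, `‖f‖ ≤ B`, with `∫ ‖∇f‖² ≤ D` differs from some constant
vector `c` with `‖c‖ ≤ B` by an `L⁶` field with `(∫ ‖f − c‖⁶)^{1/6} ≤ C_S √D` (the tree's
cut-off/Poincaré/Gagliardo–Nirenberg–Sobolev/Bolzano–Weierstrass/Fatou argument, keeping the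
level). -/
theorem exists_const_sub_lsix_le :
    ∃ CS : ℝ, 0 < CS ∧ ∀ (f : EuclideanSpace ℝ (Fin 3) → EuclideanSpace ℝ (Fin 3)),
      ContDiff ℝ 1 f → ∀ (B : ℝ), (∀ x, ‖f x‖ ≤ B) → ∀ (D : ℝ), 0 ≤ D →
      (∫⁻ x, ‖fderiv ℝ f x‖ₑ ^ 2) ≤ ENNReal.ofReal D →
      ∃ c : EuclideanSpace ℝ (Fin 3), ‖c‖ ≤ B ∧ MemLp (fun x => f x - c) 6 volume ∧
        (∫ x, ‖f x - c‖ ^ (6 : ℝ)) ^ (1 / 6 : ℝ) ≤ CS * Real.sqrt D := by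
  obtain ⟨C, -, hC⟩ := exists_norm_fderiv_cutoff_le (E := EuclideanSpace ℝ (Fin 3))
  set Kg : ℝ≥0 := SNormLESNormFDerivOfEqConst (EuclideanSpace ℝ (Fin 3))
      (volume : Measure (EuclideanSpace ℝ (Fin 3))) 2 with hKg
  refine ⟨(Kg : ℝ) * Real.sqrt (3 * (2 + 1728 * C ^ 2)) + 1, by positivity, ?_⟩
  intro f hf B hB D hD hgrad
  -- the Frobenius Dirichlet energy is at most `3D`
  set EF : ℝ≥0∞ := ∫⁻ x, ENNReal.ofReal (frobeniusNormSq (fderiv ℝ f x)) with hEF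
  have hEF_le : EF ≤ 3 * ENNReal.ofReal D := by
    calc EF ≤ ∫⁻ x, 3 * ‖fderiv ℝ f x‖ₑ ^ 2 :=
          lintegral_mono fun x => ofReal_frobeniusNormSq_le_three_mul_enorm_sq _
      _ = 3 * ∫⁻ x, ‖fderiv ℝ f x‖ₑ ^ 2 := by
          rw [lintegral_const_mul' _ _ (by norm_num)]
      _ ≤ 3 * ENNReal.ofReal D := by gcongr
  have h3D : (3 : ℝ≥0∞) * ENNReal.ofReal D ≠ ⊤ :=
    ENNReal.mul_ne_top (by norm_num) ENNReal.ofReal_ne_top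
  have hEF_ne : EF ≠ ⊤ := ne_top_of_le_ne_top h3D hEF_le
  -- the level
  set L : ℝ≥0∞ := (Kg : ℝ≥0∞) * ((2 + ENNReal.ofReal (1728 * C ^ 2)) * EF) ^ (1 / 2 : ℝ) with hL
  have h2C : (2 : ℝ≥0∞) + ENNReal.ofReal (1728 * C ^ 2) ≠ ⊤ :=
    ENNReal.add_ne_top.2 ⟨ENNReal.ofNat_ne_top, ENNReal.ofReal_ne_top⟩
  have hLtop : L < ⊤ := by
    refine ENNReal.mul_lt_top ENNReal.coe_lt_top (ENNReal.rpow_lt_top_of_nonneg (by norm_num) ?_)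
    exact ENNReal.mul_ne_top h2C hEF_ne
  -- averages on large balls and a convergent subsequence
  set a : ℕ → EuclideanSpace ℝ (Fin 3) := fun n =>
    ⨍ z in Metric.ball (0 : EuclideanSpace ℝ (Fin 3)) (3 * ((n : ℝ) + 1)), f z with ha
  have ha_mem : ∀ n, a n ∈ Metric.closedBall (0 : EuclideanSpace ℝ (Fin 3)) B := fun n =>
    mem_closedBall_zero_iff.2 (sobolevModConst_norm_setAverage_le hB 0 (by positivity))
  obtain ⟨c, hcmem, φ, hφ, hφc⟩ := tendsto_subseq_of_bounded Metric.isBounded_closedBall ha_mem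
  have hcB : ‖c‖ ≤ B := by
    rw [Metric.isClosed_closedBall.closure_eq] at hcmem
    exact mem_closedBall_zero_iff.1 hcmem
  -- truncated fluctuations converge to `f - c` with `L⁶` norms `≤ L`
  set F : ℕ → EuclideanSpace ℝ (Fin 3) → EuclideanSpace ℝ (Fin 3) := fun k =>
    (Metric.ball (0 : EuclideanSpace ℝ (Fin 3)) ((φ k : ℝ) + 1)).indicator
      (fun x => f x - a (φ k)) with hF
  have hFmeas : ∀ k, AEStronglyMeasurable (F k) volume := fun k =>
    (hf.continuous.sub continuous_const).aestronglyMeasurable.indicator measurableSet_ball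
  have hFbd : ∀ᶠ k in atTop, eLpNorm (F k) 6 volume ≤ L := Eventually.of_forall fun k =>
    sobolevModConst_eLpNorm_indicator_le (by positivity : (0 : ℝ) < (φ k : ℝ) + 1)
      (hC _ (by positivity)) hf
  have hφtop : Tendsto (fun k => (φ k : ℝ) + 1) atTop atTop :=
    (tendsto_natCast_atTop_atTop.comp hφ.tendsto_atTop).atTop_add tendsto_const_nhds
  have hFlim : ∀ᵐ x ∂(volume : Measure (EuclideanSpace ℝ (Fin 3))),
      Tendsto (fun k => F k x) atTop (𝓝 (f x - c)) := by
    refine ae_of_all _ fun x => ?_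
    have h1 : Tendsto (fun k => f x - a (φ k)) atTop (𝓝 (f x - c)) :=
      tendsto_const_nhds.sub hφc
    refine h1.congr' ?_
    filter_upwards [hφtop.eventually_gt_atTop ‖x‖] with k hk
    simp only [hF]
    rw [indicator_of_mem (mem_ball_zero_iff.2 hk)]
  have hsix : eLpNorm (fun x => f x - c) 6 volume ≤ L :=
    Lp.eLpNorm_le_of_ae_tendsto hFbd hFmeas hFlim
  have hmem : MemLp (fun x => f x - c) 6 volume :=
    ⟨(hf.continuous.sub continuous_const).aestronglyMeasurable, hsix.trans_lt hLtop⟩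
  refine ⟨c, hcB, hmem, ?_⟩
  -- pass to real numbers
  rw [hmem.eLpNorm_eq_integral_rpow_norm (by norm_num) (by norm_num)] at hsix
  simp only [ENNReal.toReal_ofNat] at hsix
  have hreal : (∫ x, ‖f x - c‖ ^ (6 : ℝ)) ^ (6 : ℝ)⁻¹ ≤ L.toReal :=
    (ENNReal.ofReal_le_iff_le_toReal hLtop.ne).1 hsix
  rw [one_div]
  refine hreal.trans ?_
  -- `L.toReal ≤ Kg √(3(2+1728C²)) √D`
  have hEFr : EF.toReal ≤ 3 * D := by
    have := ENNReal.toReal_mono h3D hEF_le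
    rwa [ENNReal.toReal_mul, ENNReal.toReal_ofReal hD, ENNReal.toReal_ofNat] at this
  have hLr : L.toReal = (Kg : ℝ) * ((2 + 1728 * C ^ 2) * EF.toReal) ^ (1 / 2 : ℝ) := by
    rw [hL, ENNReal.toReal_mul, ENNReal.coe_toReal, ← ENNReal.toReal_rpow, ENNReal.toReal_mul,
      ENNReal.toReal_add ENNReal.ofNat_ne_top ENNReal.ofReal_ne_top, ENNReal.toReal_ofNat,
      ENNReal.toReal_ofReal (by positivity)]
  rw [hLr]
  have hsq : ((2 + 1728 * C ^ 2) * EF.toReal) ^ (1 / 2 : ℝ) ≤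
      Real.sqrt (3 * (2 + 1728 * C ^ 2)) * Real.sqrt D := by
    rw [← Real.sqrt_mul (by positivity), ← Real.sqrt_eq_rpow]
    refine Real.sqrt_le_sqrt ?_
    calc (2 + 1728 * C ^ 2) * EF.toReal ≤ (2 + 1728 * C ^ 2) * (3 * D) := by gcongr
      _ = 3 * (2 + 1728 * C ^ 2) * D := by ring
  have hD0 : 0 ≤ Real.sqrt D := Real.sqrt_nonneg _
  calc (Kg : ℝ) * ((2 + 1728 * C ^ 2) * EF.toReal) ^ (1 / 2 : ℝ)
      ≤ (Kg : ℝ) * (Real.sqrt (3 * (2 + 1728 * C ^ 2)) * Real.sqrt D) := by gcongr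
    _ = ((Kg : ℝ) * Real.sqrt (3 * (2 + 1728 * C ^ 2))) * Real.sqrt D := by ring
    _ ≤ ((Kg : ℝ) * Real.sqrt (3 * (2 + 1728 * C ^ 2)) + 1) * Real.sqrt D := by
        gcongr; linarith

/-! ### The time weight `∫_{4t}^{t} (t − σ)^{-3/4} dσ` -/

/-- For `t < 0` the weight `σ ↦ (t − σ)^{-3/4}` is integrable on `(4t, t)`. -/
theorem integrableOn_rpow_sub_threeQuarters {t : ℝ} (ht : t < 0) :
    IntegrableOn (fun σ : ℝ => (t - σ) ^ (-(3 / 4 : ℝ))) (Ioo (4 * t) t) := by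
  have h4 : 4 * t ≤ t := by linarith
  have hII : IntervalIntegrable (fun x : ℝ => x ^ (-(3 / 4 : ℝ))) volume (-(3 * t)) 0 :=
    intervalIntegral.intervalIntegrable_rpow' (by norm_num)
  have hc := hII.comp_sub_left t
  have e1 : t - -(3 * t) = 4 * t := by ring
  have e2 : t - 0 = t := by ring
  rw [e1, e2] at hc
  exact (intervalIntegrable_iff_integrableOn_Ioo_of_le h4).1 hc

/-- `∫_{(4t, t)} (t − σ)^{-3/4} dσ = 4 (−3t)^{1/4}` for `t < 0`. -/
theorem integral_rpow_sub_threeQuarters {t : ℝ} (ht : t < 0) :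
    ∫ σ in Ioo (4 * t) t, (t - σ) ^ (-(3 / 4 : ℝ)) = 4 * (-(3 * t)) ^ (1 / 4 : ℝ) := by
  have h4 : 4 * t ≤ t := by linarith
  rw [← integral_Ioc_eq_integral_Ioo, ← intervalIntegral.integral_of_le h4,
    intervalIntegral.integral_comp_sub_left (fun x : ℝ => x ^ (-(3 / 4 : ℝ))) t]
  have e1 : t - t = 0 := by ring
  have e2 : t - 4 * t = -(3 * t) := by ring
  rw [e1, e2, integral_rpow (Or.inl (by norm_num))]
  have e3 : (-(3 / 4 : ℝ)) + 1 = 1 / 4 := by norm_num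
  rw [e3, Real.zero_rpow (by norm_num), sub_zero]
  ring

/-- `√(−4t) = 2 √(−t)`. -/
theorem sqrt_neg_four_mul' (t : ℝ) : Real.sqrt (-(4 * t)) = 2 * Real.sqrt (-t) := by
  rw [show -(4 * t) = 2 ^ 2 * -t by ring, Real.sqrt_mul (by norm_num), Real.sqrt_sq (by norm_num)]

/-- `(−3t)^{1/4} ≤ 2 √(√(−t))` for `t ≤ 0` (as `3 ≤ 16`). -/
theorem rpow_quarter_le {t : ℝ} (ht : t ≤ 0) :
    (-(3 * t)) ^ (1 / 4 : ℝ) ≤ 2 * Real.sqrt (Real.sqrt (-t)) := by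
  set ρ : ℝ := Real.sqrt (Real.sqrt (-t)) with hρ
  have hρ0 : 0 ≤ ρ := Real.sqrt_nonneg _
  have hρ4 : ρ ^ 4 = -t := by
    rw [show ρ ^ 4 = (ρ ^ 2) ^ 2 by ring, hρ, Real.sq_sqrt (Real.sqrt_nonneg _),
      Real.sq_sqrt (by linarith)]
  have hle : -(3 * t) ≤ (2 * ρ) ^ 4 := by rw [mul_pow, hρ4]; linarith
  calc (-(3 * t)) ^ (1 / 4 : ℝ) ≤ ((2 * ρ) ^ 4) ^ (1 / 4 : ℝ) :=
        Real.rpow_le_rpow (by linarith) hle (by norm_num)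
    _ = 2 * ρ := by
        rw [show (1 / 4 : ℝ) = ((4 : ℕ) : ℝ)⁻¹ by norm_num,
          Real.pow_rpow_inv_natCast (by positivity) (by norm_num)]

/-! ### The stub -/

/-- **Stub `stub_smallDissipationGap` (BC5 rung of the birth skeleton of crux
`FiniteDissipationLiouville`, stmt-NavierStokesRegularity-22144): the small-dissipation gap.**
There is an absolute `K₀ > 0` such that every Type-I ancient mild field in the KNSS gauge whose
slices obey the quarter-rate dissipation law with constant `K ≤ K₀` vanishes identically on
`t < 0` (statement and proof in the module docstring). -/
theorem stub_smallDissipationGap :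
    ∃ K₀ : ℝ, 0 < K₀ ∧ ∀ (C K : ℝ)
      (w : ℝ → EuclideanSpace ℝ (Fin 3) → EuclideanSpace ℝ (Fin 3)), K ≤ K₀ →
      Literature.Analysis.FluidPDE.IsTypeIAncientMild C w →
      (∀ s : ℝ, s < 0 → ∫⁻ x, ‖fderiv ℝ (w s) x‖ₑ ^ 2 ≤ ENNReal.ofReal (K / Real.sqrt (-s))) →
      ∀ t < 0, ∀ x, w t x = 0 := by
  obtain ⟨C₆, hC₆, hslice⟩ := exists_norm_integral_oseenKernel_le_lsix
  obtain ⟨CS, hCS, hsob⟩ := exists_const_sub_lsix_le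
  set κ : ℝ := 8 * C₆ * CS with hκ
  have hκ0 : 0 < κ := by positivity
  set K₀ : ℝ := (1 / (4 * κ + 4)) ^ 2 with hK₀
  have hK₀0 : 0 < K₀ := by positivity
  have hsK₀ : Real.sqrt K₀ = 1 / (4 * κ + 4) := by
    rw [hK₀, Real.sqrt_sq (by positivity)]
  have hκK : κ * Real.sqrt K₀ ≤ 1 / 4 := by
    rw [hsK₀, mul_one_div, div_le_iff₀ (by positivity)]
    linarith
  refine ⟨K₀, hK₀0, ?_⟩
  intro C K w hKle hw hDK
  -- the law with the constant `K₀`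
  have hD : ∀ s < 0, ∫⁻ x, ‖fderiv ℝ (w s) x‖ₑ ^ 2 ≤ ENNReal.ofReal (K₀ / Real.sqrt (-s)) :=
    fun s hs => (hDK s hs).trans
      (ENNReal.ofReal_le_ofReal (div_le_div_of_nonneg_right hKle (Real.sqrt_nonneg _)))
  have hC0 : 0 ≤ C := hw.nonneg
  -- the scale-invariant supremum `B`
  set S : Set ℝ := {r | ∃ t : ℝ, t < 0 ∧ ∃ x : EuclideanSpace ℝ (Fin 3),
    r = Real.sqrt (-t) * ‖w t x‖} with hS
  have hSb : BddAbove S := by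
    refine ⟨C, ?_⟩
    rintro r ⟨t, ht, x, rfl⟩
    have hs : 0 < Real.sqrt (-t) := Real.sqrt_pos.2 (by linarith)
    calc Real.sqrt (-t) * ‖w t x‖ ≤ Real.sqrt (-t) * (C / Real.sqrt (-t)) := by
          gcongr; exact hw.norm_le ht x
      _ = C := by field_simp
  have hSn : S.Nonempty := ⟨_, -1, by norm_num, 0, rfl⟩
  set B : ℝ := sSup S with hB
  have hqB : ∀ t < 0, ∀ x, Real.sqrt (-t) * ‖w t x‖ ≤ B := fun t ht x =>
    le_csSup hSb ⟨t, ht, x, rfl⟩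
  have hB0 : 0 ≤ B := le_trans (by positivity) (hqB (-1) (by norm_num) 0)
  have hptw : ∀ σ < 0, ∀ y, ‖w σ y‖ ≤ B / Real.sqrt (-σ) := by
    intro σ hσ y
    have hs : 0 < Real.sqrt (-σ) := Real.sqrt_pos.2 (by linarith)
    rw [le_div_iff₀ hs, mul_comm]
    exact hqB σ hσ y
  -- the key estimate `√(-t) ‖w(t, x)‖ ≤ B/2 + κ √K₀ B`
  have hkey : ∀ t < 0, ∀ x, Real.sqrt (-t) * ‖w t x‖ ≤ B / 2 + κ * Real.sqrt K₀ * B := by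
    intro t ht x
    set r : ℝ := Real.sqrt (-t) with hr
    have hr0 : 0 < r := Real.sqrt_pos.2 (by linarith)
    set ρ : ℝ := Real.sqrt r with hρ
    have hρ0 : 0 < ρ := Real.sqrt_pos.2 hr0
    have hρ2 : ρ ^ 2 = r := Real.sq_sqrt hr0.le
    -- the mild identity between `4t` and `t`
    have hmild := hw.mild_eq_heatExtension (s := 4 * t) (t := t) (by linarith) ht x
    -- the caloric term
    have hheat : ‖UnboundedOperators.heatExtension (w (4 * t)) (t - 4 * t) x‖ ≤ B / (2 * r) := by
      have hb : ∀ z, ‖w (4 * t) z‖ ≤ B / (2 * r) := by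
        intro z
        have := hptw (4 * t) (by linarith) z
        rwa [sqrt_neg_four_mul', ← hr] at this
      exact UnboundedOperators.norm_heatExtension_le_of_bound hb (by linarith) x
    -- the Duhamel term
    set Q : ℝ := C₆ * (B / r) * (CS * (Real.sqrt K₀ / ρ)) with hQ
    have hQ0 : 0 ≤ Q := by positivity
    have hduh : ‖oseenDuhamel 1 (4 * t) w w t x‖ ≤ κ * Real.sqrt K₀ * B / r := by
      rw [oseenDuhamel_apply]
      have hG : IntegrableOn (fun σ : ℝ => Q * (t - σ) ^ (-(3 / 4 : ℝ))) (Ioo (4 * t) t) :=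
        (integrableOn_rpow_sub_threeQuarters ht).const_mul _
      have hpt : ∀ᵐ σ ∂(volume.restrict (Ioo (4 * t) t)),
          ‖∫ y, oseenKernel (1 * (t - σ)) (x - y) (w σ y) (w σ y)‖ ≤
            Q * (t - σ) ^ (-(3 / 4 : ℝ)) := by
        refine ae_restrict_of_forall_mem measurableSet_Ioo fun σ hσ => ?_
        have hσ0 : σ < 0 := hσ.2.trans ht
        have hτ : 0 < 1 * (t - σ) := by linarith [hσ.2]
        have hsσ : r ≤ Real.sqrt (-σ) := Real.sqrt_le_sqrt (by linarith [hσ.2])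
        have hsσ0 : 0 < Real.sqrt (-σ) := hr0.trans_le hsσ
        -- the slice: Sobolev modulo constants, then the `L^∞ × L⁶` kernel bound
        have hf1 : ContDiff ℝ 1 (w σ) := (hw.contDiff_slice hσ0).of_le (by exact_mod_cast le_top)
        have hA : ∀ y, ‖w σ y‖ ≤ B / Real.sqrt (-σ) := hptw σ hσ0
        have hDσ : 0 ≤ K₀ / Real.sqrt (-σ) := by positivity
        obtain ⟨c, hcA, hmem, hN⟩ := hsob (w σ) hf1 _ hA _ hDσ (hD σ hσ0)
        have h1 := hslice hτ x (hw.continuous_slice hσ0) hA hcA hmem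
        rw [one_mul] at h1 ⊢
        refine h1.trans ?_
        have hw0 : 0 ≤ (t - σ) ^ (-(3 / 4 : ℝ)) := Real.rpow_nonneg (by linarith [hσ.2]) _
        have hA_le : B / Real.sqrt (-σ) ≤ B / r := div_le_div_of_nonneg_left hB0 hr0 hsσ
        have hN_le : (∫ y, ‖w σ y - c‖ ^ (6 : ℝ)) ^ (1 / 6 : ℝ) ≤ CS * (Real.sqrt K₀ / ρ) := by
          refine hN.trans ?_
          have h1 : Real.sqrt (K₀ / Real.sqrt (-σ)) ≤ Real.sqrt (K₀ / r) :=
            Real.sqrt_le_sqrt (div_le_div_of_nonneg_left hK₀0.le hr0 hsσ)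
          rw [Real.sqrt_div' K₀ hr0.le, ← hρ] at h1
          exact mul_le_mul_of_nonneg_left h1 hCS.le
        calc C₆ * (t - σ) ^ (-(3 / 4 : ℝ)) * (B / Real.sqrt (-σ)) *
              (∫ y, ‖w σ y - c‖ ^ (6 : ℝ)) ^ (1 / 6 : ℝ)
            ≤ C₆ * (t - σ) ^ (-(3 / 4 : ℝ)) * (B / r) * (CS * (Real.sqrt K₀ / ρ)) := by
              gcongr
          _ = Q * (t - σ) ^ (-(3 / 4 : ℝ)) := by simp only [hQ]; ring
      refine (norm_integral_le_of_norm_le hG hpt).trans ?_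
      rw [MeasureTheory.integral_const_mul, integral_rpow_sub_threeQuarters ht]
      have h3 := rpow_quarter_le ht.le
      rw [← hr, ← hρ] at h3
      calc Q * (4 * (-(3 * t)) ^ (1 / 4 : ℝ)) ≤ Q * (4 * (2 * ρ)) := by gcongr
        _ = κ * Real.sqrt K₀ * B / r := by
            simp only [hQ, hκ]
            field_simp
            ring
    -- assemble
    have hnorm : ‖w t x‖ ≤ B / (2 * r) + κ * Real.sqrt K₀ * B / r := by
      rw [hmild]
      exact (norm_sub_le _ _).trans (add_le_add hheat hduh)
    calc r * ‖w t x‖ ≤ r * (B / (2 * r) + κ * Real.sqrt K₀ * B / r) := by gcongr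
      _ = B / 2 + κ * Real.sqrt K₀ * B := by field_simp
  -- bootstrap: `B ≤ B/2 + κ√K₀ B ≤ B/2 + B/4` forces `B = 0`
  have hB1 : B ≤ B / 2 + κ * Real.sqrt K₀ * B :=
    csSup_le hSn (by rintro r ⟨t, ht, x, rfl⟩; exact hkey t ht x)
  have hB2 : κ * Real.sqrt K₀ * B ≤ (1 / 4) * B := by gcongr
  have hB00 : B ≤ 0 := by linarith
  intro t ht x
  have hst : 0 < Real.sqrt (-t) := Real.sqrt_pos.2 (by linarith)
  have h' : Real.sqrt (-t) * ‖w t x‖ ≤ 0 := (hqB t ht x).trans hB00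
  have hn : ‖w t x‖ ≤ 0 := by
    by_contra hcon
    push Not at hcon
    have : 0 < Real.sqrt (-t) * ‖w t x‖ := mul_pos hst hcon
    linarith
  exact norm_le_zero_iff.1 hn

end Summit.NavierStokesRegularity.NavierStokesRegularity.Theorems.FiniteDissipationLiouville.Birth

end
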